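import Literature.MathematicalPhysics.StatisticalMechanics.ComplexSpinChessboard
import HarnessLib

/-!
# The twisted partition function of the background system as a bracket of the original complex
# spin system (Salmhofer–Seiler, CMP 139 (1991), proof of Thm. 3.21: (3.78), (3.80)–(3.83))

Fifth instalment of the discharge of the cited fact `SalmhoferSeiler1991_infraredBound` along the
printed proof (pp. 413–415); companion of `ComplexSpinChessboard` (`twistedZ`, `negNHam`) and
`ComplexSpinGaussianDomination`.  PROVED here, no named fact introduced: the identity (3.81) that
expresses the twisted partition function `Z^ε_Λ(φ)` of the BACKGROUND bracket (3.78) through the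
bracket of the ORIGINAL system (site weight `F`, bond weight `B = e^{NW}`), and `Z^ε_Λ(0) = Z_Λ`.
Honest framing: finite-volume algebra of polynomial "spin systems" at `β = 0`; nothing about
`β > 0`, the continuum, or the summit's `QCD` conjunct.

WHAT IS PRINTED (p. 413).  "Define an unnormalized background expectation value `[·]_Λ` by
`[f]_Λ = ∮ ∏_x dσ_x/(2πiσ_x) σ_x^{-N} F(σ_x) e^{εNνσ_x²} ∏_{x,y} e^{NV(σ_xσ_{x+e_μ})} f(σ)` (3.78) …
let `H^ε_Λ(φ) = (ε/2) ∑ ((σ_x - φ_x) - ε(σ_{x+e_μ} - φ_{x+e_μ}))²` (3.79) and `Z^ε_Λ(φ) =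
[e^{-NH^ε_Λ(φ)}]_Λ` (3.80), then `Z^ε_Λ(0) = Z_Λ` and `Z^ε_Λ(φ) = Z_Λ exp(-(εN/2) ∑_{x,μ} (φ_x -
εφ_{x+e_μ})²) · ⟨∏_{x,μ} exp(εN(σ_x - εσ_{x+e_μ})(φ_x - εφ_{x+e_μ}))⟩_Λ` (3.81), i.e. `Z⁺_Λ(φ) =
e^{-(N/2)(φ,-Δφ)} Z_Λ ⟨e^{N(σ,-Δφ)}⟩_Λ` (3.82) and `Z⁻_Λ(φ) = e^{(N/2)(φ,Δ̄φ)} Z_Λ ⟨e^{-N(σ,Δ̄φ)}⟩_Λ`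
(3.83)."  (`V(t) = W(t) - t`, `e^{NV(t)} = ∑ b_k t^k` (3.73); `⟨·⟩_Λ = [·]/Z_Λ` the ORIGINAL system.)

HOW IT IS TYPED.  Under the coefficient extraction of Remark 3.2 the relevant congruence is
`TruncEq N` — equality of the coefficients of all monomials `σ^m` with `m_x ≤ N` for every `x`
(congruence modulo the ideal `(σ_x^{N+1})`), a multiplicative congruence under which the top
coefficient `[·]₀` is invariant (`TruncEq.mul`, `TruncEq.coeff_topExponent_eq`); it is obtained from
the total-degree nullity `NullEq` of `ComplexSpinChessboard` for polynomials in few spins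
(`truncEq_of_nullEq_of_mem_supported`, pigeonhole).  The weights are evaluations of univariate
polynomials (`truncPoly`, `expPoly`, `Polynomial.aeval` at `σ_x` resp. `σ_xσ_y`), and the two
cancellations of (3.81) — `[F(σ)e^{εNνσ²}]_{≤N} · e^{-εNνσ²} ≡ F` (site) and `e^{NV(σσ')} · e^{Nσσ'}
≡ B(σσ')` (bond, `b_k = fluctCoeff N a k` IS the Taylor datum of `B(t)e^{-Nt}`) — are congruences
`mod T^{N+1}` (`X_pow_dvd_truncPoly_mul_expPoly`, one convolution identity) pushed to the field
algebra (`truncEq_aeval_of_X_pow_dvd`) plus `e_D^{P} e_D^{-P} ≡ 1` (`truncEq_eT_mul_eT_neg`).  The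
background site data of (3.78) are `bgSite ε N ν f = gaussTwist (εNν) f` (Taylor data of
`F(z)e^{εNνz²}`).  Completing the square (3.81) is the polynomial identity `negNHam_decomp`:
`-NH^ε_Λ(φ) = gaussConst + linObs + (-NH^ε_Λ(0))` with `gaussConst ε N φ = -(εN/2)∑(φ_x -
εφ_{x+e_μ})²` and the linear observable `linObs ε N φ = ∑_x ℓ_x σ_x`, `ℓ_x = Nε ∑_μ ((φ_x -
εφ_{x+e_μ}) - ε(φ_{x-e_μ} - εφ_x))` (`= N(-Δφ)_x` for `ε = 1`, `-N(Δ̄φ)_x` for `ε = -1`; complex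
`φ` allowed, as needed for (3.99)).

WHAT IS PROVED (0 sorry, no new `def … : Prop`).
* `TruncEq` calculus; `truncEq_X_pow_mul`, `truncEq_of_nullEq_of_mem_supported`.
* `coeff_truncPoly`, `coeff_expPoly`, `X_pow_dvd_truncPoly_mul_expPoly`, `gaussTwist_eq`,
  `fluctCoeff_eq` (`b = a ⋆₁ (-N)`), `aeval_truncPoly`, `aeval_expPoly`, `truncEq_eT_mul_eT_neg`,
  `truncEq_siteWeightC_gaussTwist`, `truncEq_bondWeightC_fluctCoeff`.
* `negNHam_decomp` (completing the square), `coeff_zero_negNHam_zero`, `coeff_zero_linObs`.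
* **(3.81)** `twistedZ_bg_eq`: `Z^ε_Λ(φ) = exp(gaussConst ε N φ) · [e_D^{linObs ε N φ}]_{F,B}` for
  `ε = ±1` (`|Λ| ≥ 2`), and **`Z^ε_Λ(0) = Z_Λ`** `twistedZ_bg_zero`.
The specialisations (3.82)/(3.83) (real resp. imaginary `φ`, `-Δ` resp. `Δ̄`) and the use of
(3.95)/(3.97) are left to the closing file of the series.

## References

* M. Salmhofer, E. Seiler, *Proof of chiral symmetry breaking in strongly coupled lattice gauge
  theory*, Commun. Math. Phys. 139 (1991) 395–432, (3.73), (3.78)–(3.83), p. 413. [SalmhoferSeiler1991]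
* J. Fröhlich, B. Simon, T. Spencer, Commun. Math. Phys. 50 (1976) 79–95 (the paper's [18]).
  [FrohlichSimonSpencer1976]
-/

noncomputable section

open MvPolynomial Finset

namespace Literature.MathematicalPhysics.StatisticalMechanics

open Literature.Probability.LatticeModels (TorusSite)
open Literature.Barriers.CriticalPhenomena.NonGibbs

namespace ComplexSpin

variable {ν L : ℕ}

/-! ### Congruence modulo the ideal `(σ_x^{N+1} : x ∈ Λ)` (Remark 3.2) -/

/-- `P ≡ P'` modulo the ideal generated by the `σ_x^{N+1}`: the coefficients of all monomials
`σ^m` with `m_x ≤ N` for every `x` agree.  Under the coefficient extraction `[·]_Λ` of Remark 3.2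
("only the Taylor truncations to degree `≤ N` matter") congruent Boltzmann weights give the same
brackets. [cite: SalmhoferSeiler1991, Remark 3.2] -/
def TruncEq (N : ℕ) (P P' : FieldAlg ν L) : Prop :=
  ∀ m : TorusSite ν L →₀ ℕ, (∀ x, m x ≤ N) → coeff m P = coeff m P'

namespace TruncEq

variable {N : ℕ}

/-- Reflexivity. [cite: SalmhoferSeiler1991, Remark 3.2] -/
theorem refl (P : FieldAlg ν L) : TruncEq N P P := fun _ _ => rfl

/-- Symmetry. [cite: SalmhoferSeiler1991, Remark 3.2] -/
theorem symm {P P' : FieldAlg ν L} (h : TruncEq N P P') : TruncEq N P' P :=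
  fun m hm => (h m hm).symm

/-- Transitivity. [cite: SalmhoferSeiler1991, Remark 3.2] -/
theorem trans {P P' P'' : FieldAlg ν L} (h : TruncEq N P P') (h' : TruncEq N P' P'') :
    TruncEq N P P'' := fun m hm => (h m hm).trans (h' m hm)

/-- Compatibility with addition. [cite: SalmhoferSeiler1991, Remark 3.2] -/
theorem add {P P' Q Q' : FieldAlg ν L} (h : TruncEq N P P') (h' : TruncEq N Q Q') :
    TruncEq N (P + Q) (P' + Q') := fun m hm => by rw [coeff_add, coeff_add, h m hm, h' m hm]

/-- `P ≡ P'` iff `P - P' ≡ 0`. [cite: SalmhoferSeiler1991, Remark 3.2] -/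
theorem of_sub {P P' : FieldAlg ν L} (h : TruncEq N (P - P') 0) : TruncEq N P P' := fun m hm => by
  have := h m hm
  rwa [coeff_sub, coeff_zero, sub_eq_zero] at this

/-- **Compatibility with multiplication** (the monomials below `σ^m` in a product come from
monomials below `σ^m` in the factors: exponents are nonnegative). [cite: SalmhoferSeiler1991, Remark 3.2] -/
theorem mul {P P' Q Q' : FieldAlg ν L} (h : TruncEq N P P') (h' : TruncEq N Q Q') :
    TruncEq N (P * Q) (P' * Q') := by
  intro m hm
  rw [coeff_mul, coeff_mul]
  refine Finset.sum_congr rfl fun p hp => ?_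
  have hsum : p.1 + p.2 = m := Finset.HasAntidiagonal.mem_antidiagonal.1 hp
  have h1 : ∀ x, p.1 x ≤ N := fun x => by
    have := DFunLike.congr_fun hsum x
    rw [Finsupp.add_apply] at this
    exact le_trans (Nat.le.intro this) (hm x)
  have h2 : ∀ x, p.2 x ≤ N := fun x => by
    have := DFunLike.congr_fun hsum x
    rw [Finsupp.add_apply, add_comm] at this
    exact le_trans (Nat.le.intro this) (hm x)
  rw [h p.1 h1, h' p.2 h2]

/-- Compatibility with finite products. [cite: SalmhoferSeiler1991, Remark 3.2] -/
theorem prod {α : Type*} {s : Finset α} {g g' : α → FieldAlg ν L}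
    (h : ∀ a ∈ s, TruncEq N (g a) (g' a)) : TruncEq N (∏ a ∈ s, g a) (∏ a ∈ s, g' a) := by
  classical
  induction s using Finset.induction_on with
  | empty => simpa using refl (1 : FieldAlg ν L)
  | insert a s ha ih =>
    rw [Finset.prod_insert ha, Finset.prod_insert ha]
    exact (h a (Finset.mem_insert_self a s)).mul (ih fun x hx => h x (Finset.mem_insert_of_mem hx))

/-- **Congruent polynomials have the same top coefficient** `[·]₀ = coeff (N,…,N)`.
[cite: SalmhoferSeiler1991, Remark 3.2] -/
theorem coeff_topExponent_eq [NeZero L] {P P' : FieldAlg ν L} (h : TruncEq N P P') :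
    coeff (topExponent N) P = coeff (topExponent N) P' :=
  h _ fun x => by rw [topExponent_apply']

end TruncEq

/-- A multiple of `σ_x^{N+1}` is congruent to `0`. [cite: SalmhoferSeiler1991, Remark 3.2] -/
theorem truncEq_X_pow_mul (N : ℕ) (x : TorusSite ν L) (R : FieldAlg ν L) :
    TruncEq N (X x ^ (N + 1) * R) 0 := by
  intro m hm
  rw [coeff_zero, X_pow_eq_monomial, coeff_monomial_mul', if_neg]
  intro hle
  have := Finsupp.single_le_iff.1 hle
  have := hm x
  omega

/-- **From total-degree nullity to congruence**: if `P - P'` involves only the spins of a set `s`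
with `|s|·N ≤ D` and all its monomials have total degree `> D`, then `P ≡ P'` modulo the
`σ_x^{N+1}` (pigeonhole). [cite: SalmhoferSeiler1991, Remark 3.2] -/
theorem truncEq_of_nullEq_of_mem_supported {D N : ℕ} {P P' : FieldAlg ν L} (h : NullEq D P P')
    {s : Finset (TorusSite ν L)} (hs : P - P' ∈ supported ℂ (↑s : Set (TorusSite ν L)))
    (hD : s.card * N ≤ D) : TruncEq N P P' := by
  refine TruncEq.of_sub fun m hm => ?_
  rw [coeff_zero]
  by_contra hne
  have hmem : m ∈ (P - P').support := mem_support_iff.2 hne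
  have hdeg : D + 1 ≤ m.degree := h m hmem
  have hvars : ↑(P - P').vars ⊆ (↑s : Set (TorusSite ν L)) := mem_supported.1 hs
  have hsub : m.support ⊆ s := fun x hx =>
    Finset.mem_coe.1 (hvars (Finset.mem_coe.2 ((mem_vars_iff_mem_support x).2 ⟨m, hmem, hx⟩)))
  have hle : m.degree ≤ s.card * N := by
    rw [Finsupp.degree_apply]
    calc ∑ x ∈ m.support, m x ≤ ∑ x ∈ m.support, N := Finset.sum_le_sum fun x _ => hm x
      _ = m.support.card * N := by rw [Finset.sum_const, smul_eq_mul]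
      _ ≤ s.card * N := Nat.mul_le_mul_right N (Finset.card_le_card hsub)
  omega

/-! ### Univariate truncated weights and exponentials, and their products modulo `T^{N+1}` -/

section Univariate

open Polynomial in
/-- The truncated Taylor polynomial `∑_{i ≤ N} g_i T^i` of a weight with Taylor data `g`
(`F`, `B`, `e^{NV}` of Def. 3.1 / (3.73), one variable `T = σ_x` or `T = σ_x σ_y`).
[cite: SalmhoferSeiler1991, Remark 3.2] -/
def truncPoly (N : ℕ) (g : ℕ → ℂ) : Polynomial ℂ :=
  ∑ i ∈ range (N + 1), Polynomial.C (g i) * Polynomial.X ^ i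

open Polynomial in
/-- The truncated exponential `∑_{n ≤ D} (c^n/n!) T^{sn}` of `e^{c T^s}` (`s = 1`: `e^{-Nt}` of
(3.73) / `e^{Nσσ'}`; `s = 2`: `e^{εNνσ²}` of (3.78)). [cite: SalmhoferSeiler1991, (3.73) and (3.78)] -/
def expPoly (s D : ℕ) (c : ℂ) : Polynomial ℂ :=
  ∑ n ∈ range (D + 1), Polynomial.C (c ^ n / (n.factorial : ℂ)) * Polynomial.X ^ (s * n)

/-- The Taylor data of the product `(∑ g_i T^i) · e^{c T^s}`:
`(g ⋆_s c)_j = ∑_{k ≤ j, s ∣ j-k} g_k c^{(j-k)/s} / ((j-k)/s)!`. [cite: SalmhoferSeiler1991, (3.73) and (3.78)] -/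
def twistData (s : ℕ) (c : ℂ) (g : ℕ → ℂ) (j : ℕ) : ℂ :=
  ∑ k ∈ range (j + 1), g k * (if s ∣ (j - k) then c ^ ((j - k) / s) / (((j - k) / s).factorial : ℂ) else 0)

/-- Coefficients of the truncated weight. [cite: SalmhoferSeiler1991, Remark 3.2] -/
theorem coeff_truncPoly (N : ℕ) (g : ℕ → ℂ) (d : ℕ) :
    (truncPoly N g).coeff d = if d ≤ N then g d else 0 := by
  rw [truncPoly, Polynomial.finsetSum_coeff]
  simp_rw [Polynomial.coeff_C_mul, Polynomial.coeff_X_pow, mul_ite, mul_one, mul_zero]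
  rw [Finset.sum_ite_eq]
  simp only [Finset.mem_range, Nat.lt_succ_iff]

/-- Coefficients of the truncated exponential of `c T^s`. [cite: SalmhoferSeiler1991, (3.73) and (3.78)] -/
theorem coeff_expPoly {s : ℕ} (hs : 0 < s) (D : ℕ) (c : ℂ) (d : ℕ) :
    (expPoly s D c).coeff d =
      if s ∣ d ∧ d / s ≤ D then c ^ (d / s) / ((d / s).factorial : ℂ) else 0 := by
  rw [expPoly, Polynomial.finsetSum_coeff]
  simp_rw [Polynomial.coeff_C_mul, Polynomial.coeff_X_pow, mul_ite, mul_one, mul_zero]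
  by_cases hsd : s ∣ d
  · obtain ⟨q, rfl⟩ := hsd
    rw [Nat.mul_div_cancel_left q hs]
    have : ∀ n, (s * q = s * n) ↔ (q = n) := fun n =>
      ⟨fun h => Nat.eq_of_mul_eq_mul_left hs h, fun h => by rw [h]⟩
    simp_rw [this]
    rw [Finset.sum_ite_eq]
    have hdvd : s ∣ s * q := Dvd.intro q rfl
    simp only [Finset.mem_range, Nat.lt_succ_iff, hdvd, true_and]
  · rw [if_neg (fun h => hsd h.1)]
    refine Finset.sum_eq_zero fun n _ => ?_
    rw [if_neg]
    rintro rfl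
    exact hsd (Dvd.intro n rfl)

open Polynomial in
/-- **Multiplying a truncated weight by a truncated exponential**:
`(∑_{i ≤ N} g_i T^i)(∑_{n ≤ D} c^n T^{sn}/n!) ≡ ∑_{j ≤ N} (g ⋆_s c)_j T^j (mod T^{N+1})` for
`N ≤ D`, `s ≥ 1`. [cite: SalmhoferSeiler1991, (3.73) and (3.78)] -/
theorem X_pow_dvd_truncPoly_mul_expPoly {s : ℕ} (hs : 0 < s) {N D : ℕ} (hND : N ≤ D) (c : ℂ)
    (g : ℕ → ℂ) :
    Polynomial.X ^ (N + 1) ∣ truncPoly N g * expPoly s D c - truncPoly N (twistData s c g) := by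
  rw [Polynomial.X_pow_dvd_iff]
  intro d hd
  have hdN : d ≤ N := Nat.lt_succ_iff.1 hd
  rw [Polynomial.coeff_sub, Polynomial.coeff_mul, Finset.Nat.sum_antidiagonal_eq_sum_range_succ_mk,
    coeff_truncPoly, if_pos hdN, twistData, sub_eq_zero]
  refine Finset.sum_congr rfl fun k hk => ?_
  have hkd : k ≤ d := Nat.lt_succ_iff.1 (Finset.mem_range.1 hk)
  simp only [coeff_truncPoly, coeff_expPoly hs, if_pos (hkd.trans hdN)]
  congr 1
  by_cases hdiv : s ∣ (d - k)
  · have hle : (d - k) / s ≤ D := (Nat.div_le_self _ _).trans ((Nat.sub_le d k).trans (hdN.trans hND))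
    rw [if_pos ⟨hdiv, hle⟩, if_pos hdiv]
  · rw [if_neg (fun h => hdiv h.1), if_neg hdiv]

/-- The site-weight twist: Taylor data of `F(z) e^{c z²}` truncated, for real data and real `c`
(`(f ⋆₂ c)_j = ∑_{b ≤ j, b even} f_{j-b} c^{b/2}/(b/2)!`); with `c = εNν` these are the Taylor
data of the background site weight `F(σ_x) e^{εNνσ_x²}` of (3.78). [cite: SalmhoferSeiler1991, (3.78)] -/
def gaussTwist (c : ℝ) (f : ℕ → ℝ) (j : ℕ) : ℝ :=
  ∑ k ∈ range (j + 1), f k * (if 2 ∣ (j - k) then c ^ ((j - k) / 2) / (((j - k) / 2).factorial : ℝ) else 0)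

/-- The site-weight twist is the `s = 2` twist. [cite: SalmhoferSeiler1991, (3.78)] -/
theorem gaussTwist_eq (c : ℝ) (f : ℕ → ℝ) (j : ℕ) :
    ((gaussTwist c f j : ℝ) : ℂ) = twistData 2 (c : ℂ) (fun i => ((f i : ℝ) : ℂ)) j := by
  rw [gaussTwist, twistData, Complex.ofReal_sum]
  refine Finset.sum_congr rfl fun k _ => ?_
  split_ifs <;> push_cast <;> ring

/-- **`b_k` (3.73) is the `s = 1` twist of the bond data by `e^{-Nt}`**: `e^{NV(t)} = B(t) e^{-Nt}`.
[cite: SalmhoferSeiler1991, (3.73)] -/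
theorem fluctCoeff_eq (N : ℕ) (a : ℕ → ℝ) (k : ℕ) :
    ((fluctCoeff N a k : ℝ) : ℂ) = twistData 1 (-(N : ℂ)) (fun i => ((a i : ℝ) : ℂ)) k := by
  rw [fluctCoeff, twistData, Complex.ofReal_sum]
  refine Finset.sum_congr rfl fun j _ => ?_
  simp only [Nat.one_dvd, if_true, Nat.div_one]
  push_cast
  ring

end Univariate

/-! ### Evaluating the univariate polynomials at `σ_x` and `σ_x σ_y` -/

section Eval

/-- `∑_{i ≤ N} g_i t^i` evaluated in the field algebra. [cite: SalmhoferSeiler1991, Remark 3.2] -/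
theorem aeval_truncPoly (N : ℕ) (g : ℕ → ℂ) (t : FieldAlg ν L) :
    Polynomial.aeval t (truncPoly N g) = ∑ i ∈ range (N + 1), C (g i) * t ^ i := by
  simp [truncPoly, map_sum, map_mul, map_pow, Polynomial.aeval_X, Polynomial.aeval_C,
    MvPolynomial.algebraMap_eq]

/-- The truncated exponential `e_D^{c t^s}` is the evaluation of `expPoly`. [cite: SalmhoferSeiler1991, (3.73) and (3.78)] -/
theorem aeval_expPoly (s D : ℕ) (c : ℂ) (t : FieldAlg ν L) :
    Polynomial.aeval t (expPoly s D c) = eT D (C c * t ^ s) := by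
  rw [expPoly, eT, map_sum]
  refine Finset.sum_congr rfl fun n _ => ?_
  rw [map_mul, Polynomial.aeval_C, MvPolynomial.algebraMap_eq, map_pow, Polynomial.aeval_X,
    mul_pow, ← map_pow C, ← pow_mul, ← mul_assoc, ← map_mul]
  congr 2
  rw [div_eq_mul_inv, mul_comm]

/-- The site weight with data `f` is `truncPoly` at `σ_x`. [cite: SalmhoferSeiler1991, Def. 3.1 and Remark 3.2] -/
theorem siteWeightC_eq_aeval (N : ℕ) (f : ℕ → ℝ) (x : TorusSite ν L) :
    siteWeightC N f x = Polynomial.aeval (X x) (truncPoly N fun i => ((f i : ℝ) : ℂ)) := by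
  rw [aeval_truncPoly, siteWeightC]

/-- The bond weight with data `b` is `truncPoly` at `σ_x σ_y`. [cite: SalmhoferSeiler1991, Def. 3.1 and Remark 3.2] -/
theorem bondWeightC_eq_aeval (N : ℕ) (b : ℕ → ℝ) (x y : TorusSite ν L) :
    bondWeightC N b x y = Polynomial.aeval (X x * X y) (truncPoly N fun i => ((b i : ℝ) : ℂ)) := by
  rw [aeval_truncPoly, bondWeightC]

/-- **Pushing a congruence mod `T^{N+1}` to the field algebra**: evaluating at a multiple `σ_x · u`
of a spin turns `T^{N+1} ∣ p - q` into `p(t) ≡ q(t)` modulo the `σ_x^{N+1}`.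
[cite: SalmhoferSeiler1991, Remark 3.2] -/
theorem truncEq_aeval_of_X_pow_dvd {N : ℕ} {p q : Polynomial ℂ}
    (h : Polynomial.X ^ (N + 1) ∣ p - q) (x : TorusSite ν L) (u : FieldAlg ν L) :
    TruncEq N (Polynomial.aeval (X x * u) p) (Polynomial.aeval (X x * u) q) := by
  obtain ⟨r, hr⟩ := h
  refine TruncEq.of_sub ?_
  rw [← map_sub, hr, map_mul, map_pow, Polynomial.aeval_X, mul_pow, mul_assoc]
  exact truncEq_X_pow_mul N x _

/-- `e_D^{0} = 1`. [cite: SalmhoferSeiler1991, Thm. 3.20 (proof)] -/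
theorem eT_zero (D : ℕ) : eT D (0 : FieldAlg ν L) = 1 := by
  unfold eT
  rw [Finset.sum_range_succ', pow_zero, Nat.factorial_zero]
  simp

/-- **`e_D^{c t^s} · e_D^{-c t^s} ≡ 1`** modulo the `σ_x^{N+1}`, for `t = σ_x · u` a monomial in the
spins of a set `s₀ ∋ x` with `|s₀| N ≤ D` and `s ≥ 1` (the exponential series of `0`, truncated).
[cite: SalmhoferSeiler1991, Remark 3.2 and (3.81)] -/
theorem truncEq_eT_mul_eT_neg {N D : ℕ} {s₀ : Finset (TorusSite ν L)} (hD : s₀.card * N ≤ D)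
    {t : FieldAlg ν L} (ht : t ∈ supported ℂ (↑s₀ : Set (TorusSite ν L))) (ht0 : coeff 0 t = 0)
    {s : ℕ} (hs : 0 < s) (c : ℂ) :
    TruncEq N (eT D (C c * t ^ s) * eT D (C (-c) * t ^ s)) 1 := by
  have hP : coeff 0 (C c * t ^ s) = 0 := by
    rw [coeff_C_mul, ← constantCoeff_eq, map_pow, constantCoeff_eq, ht0, zero_pow hs.ne', mul_zero]
  have hT : coeff 0 (C (-c) * t ^ s) = 0 := by
    rw [coeff_C_mul, ← constantCoeff_eq, map_pow, constantCoeff_eq, ht0, zero_pow hs.ne', mul_zero]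
  have hnull : NullEq D (eT D (C c * t ^ s) * eT D (C (-c) * t ^ s)) 1 := by
    have h := (eT_add_nullEq D hP hT).symm
    rwa [show C c * t ^ s + C (-c) * t ^ s = 0 by rw [map_neg]; ring, eT_zero] at h
  refine truncEq_of_nullEq_of_mem_supported hnull ?_ hD
  have hts : ∀ a : ℂ, C a * t ^ s ∈ supported ℂ (↑s₀ : Set (TorusSite ν L)) := fun a =>
    Subalgebra.mul_mem _ (Subalgebra.algebraMap_mem _ a) (Subalgebra.pow_mem _ ht s)
  have heT : ∀ a : ℂ, eT D (C a * t ^ s) ∈ supported ℂ (↑s₀ : Set (TorusSite ν L)) := fun a =>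
    Subalgebra.sum_mem _ fun n _ =>
      Subalgebra.mul_mem _ (Subalgebra.algebraMap_mem _ _) (Subalgebra.pow_mem _ (hts a) n)
  exact Subalgebra.sub_mem _ (Subalgebra.mul_mem _ (heT c) (heT (-c))) (Subalgebra.one_mem _)

/-- **The background site weight times the Gaussian site factor is the original site weight**:
`[F(σ_x) e^{cσ_x²}]_{≤N} · e_D^{-cσ_x²} ≡ F^{≤N}(σ_x)` modulo `σ_x^{N+1}` (`c = εNν`; the
cancellation behind "`Z^ε_Λ(0) = Z_Λ`" and (3.81)). [cite: SalmhoferSeiler1991, (3.78) and (3.81)] -/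
theorem truncEq_siteWeightC_gaussTwist {N D : ℕ} (hND : N ≤ D) (c : ℝ) (f : ℕ → ℝ)
    (x : TorusSite ν L) :
    TruncEq N (siteWeightC N (gaussTwist c f) x * eT D (C (-(c : ℂ)) * X x ^ 2))
      (siteWeightC N f x) := by
  -- `[F e^{cz²}]_{≤N}(σ_x) ≡ F^{≤N}(σ_x) · e_D^{cσ_x²}`
  have h1 : TruncEq N (siteWeightC N (gaussTwist c f) x)
      (siteWeightC N f x * eT D (C (c : ℂ) * X x ^ 2)) := by
    have hfun : (fun i => ((gaussTwist c f i : ℝ) : ℂ)) =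
        twistData 2 (c : ℂ) (fun i => ((f i : ℝ) : ℂ)) := funext fun i => gaussTwist_eq c f i
    rw [siteWeightC_eq_aeval, siteWeightC_eq_aeval, hfun, ← aeval_expPoly, ← map_mul]
    have h := truncEq_aeval_of_X_pow_dvd
      (X_pow_dvd_truncPoly_mul_expPoly (s := 2) two_pos hND (c : ℂ) fun i => ((f i : ℝ) : ℂ)) x 1
    rw [mul_one] at h
    exact h.symm
  refine (h1.mul (TruncEq.refl _)).trans ?_
  rw [mul_assoc]
  have h2 : TruncEq N (eT D (C (c : ℂ) * X x ^ 2) * eT D (C (-(c : ℂ)) * X x ^ 2)) 1 :=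
    truncEq_eT_mul_eT_neg (s₀ := {x}) (by rw [Finset.card_singleton, one_mul]; exact hND)
      (X_mem_supported.2 (by simp)) (coeff_zero_X x) two_pos (c : ℂ)
  have := (TruncEq.refl (siteWeightC N f x)).mul h2
  rwa [mul_one] at this

/-- **The background bond weight times the Gaussian link factor is the original bond weight**:
`e^{NV}(σ_xσ_y)_{≤N} · e_D^{Nσ_xσ_y} ≡ B^{≤N}(σ_xσ_y)` modulo `σ_x^{N+1}, σ_y^{N+1}` (`V = W - t`,
`B = e^{NW}`; requires `2N ≤ D`). [cite: SalmhoferSeiler1991, (3.73), (3.78) and (3.81)] -/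
theorem truncEq_bondWeightC_fluctCoeff {N D : ℕ} (hND : 2 * N ≤ D) (a : ℕ → ℝ)
    (x y : TorusSite ν L) :
    TruncEq N (bondWeightC N (fluctCoeff N a) x y * eT D (C (N : ℂ) * (X x * X y) ^ 1))
      (bondWeightC N a x y) := by
  have hND' : N ≤ D := by omega
  have h1 : TruncEq N (bondWeightC N (fluctCoeff N a) x y)
      (bondWeightC N a x y * eT D (C (-(N : ℂ)) * (X x * X y) ^ 1)) := by
    have hfun : (fun i => ((fluctCoeff N a i : ℝ) : ℂ)) =
        twistData 1 (-(N : ℂ)) (fun i => ((a i : ℝ) : ℂ)) := funext fun i => fluctCoeff_eq N a i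
    rw [bondWeightC_eq_aeval, bondWeightC_eq_aeval, hfun, ← aeval_expPoly, ← map_mul]
    exact (truncEq_aeval_of_X_pow_dvd
      (X_pow_dvd_truncPoly_mul_expPoly (s := 1) one_pos hND' (-(N : ℂ)) fun i => ((a i : ℝ) : ℂ))
      x (X y)).symm
  refine (h1.mul (TruncEq.refl _)).trans ?_
  rw [mul_assoc]
  classical
  have hcard : ({x, y} : Finset (TorusSite ν L)).card * N ≤ D :=
    (Nat.mul_le_mul_right N (Finset.card_le_two)).trans hND
  have hmem : X x * X y ∈ supported ℂ (↑({x, y} : Finset (TorusSite ν L)) : Set (TorusSite ν L)) :=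
    Subalgebra.mul_mem _ (X_mem_supported.2 (by simp)) (X_mem_supported.2 (by simp))
  have h0 : coeff 0 (X x * X y : FieldAlg ν L) = 0 := by
    rw [← constantCoeff_eq, map_mul, constantCoeff_X, zero_mul]
  have h2 := truncEq_eT_mul_eT_neg hcard hmem h0 one_pos (-(N : ℂ))
  rw [neg_neg] at h2
  have := (TruncEq.refl (bondWeightC N a x y)).mul h2
  rwa [mul_one] at this

end Eval

/-! ### `-N H^ε_Λ(φ)` = constant + linear + `-N H^ε_Λ(0)` ((3.81): completing the square) -/

section Decomposition

variable [NeZero L]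

/-- The link combination `φ_x - ε φ_{x+e_μ}` of (3.81). [cite: SalmhoferSeiler1991, (3.81)] -/
def linkCfg (ε : ℤ) (φ : TorusSite ν L → ℂ) (x : TorusSite ν L) (μ : Fin ν) : ℂ :=
  φ x - ε * φ (x + Pi.single μ 1)

/-- **The Gaussian constant** `-(εN/2) ∑_{x,μ} (φ_x - εφ_{x+e_μ})²` of (3.81) (`= -(N/2)(φ,-Δφ)`
for `ε = 1`, `= (N/2)(φ, Δ̄φ)` for `ε = -1`, (3.82)–(3.83)). [cite: SalmhoferSeiler1991, (3.81)–(3.83)] -/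
def gaussConst (ε : ℤ) (N : ℕ) (φ : TorusSite ν L → ℂ) : ℂ :=
  -((N : ℂ) * ε / 2) * ∑ x : TorusSite ν L, ∑ μ : Fin ν, linkCfg ε φ x μ ^ 2

/-- The coefficient of `σ_x` in the linear part of `-N H^ε_Λ(φ)`:
`Nε ∑_μ ((φ_x - εφ_{x+e_μ}) - ε(φ_{x-e_μ} - εφ_x))` (`= N(-Δφ)_x` for `ε = 1`, `= -N(Δ̄φ)_x` for
`ε = -1`). [cite: SalmhoferSeiler1991, (3.81)–(3.83)] -/
def linCoeff (ε : ℤ) (N : ℕ) (φ : TorusSite ν L → ℂ) (x : TorusSite ν L) : ℂ :=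
  (N : ℂ) * ε * ∑ μ : Fin ν, (linkCfg ε φ x μ - ε * linkCfg ε φ (x - Pi.single μ 1) μ)

/-- **The linear observable** `εN ∑_{x,μ} (σ_x - εσ_{x+e_μ})(φ_x - εφ_{x+e_μ}) = ∑_x ℓ_x σ_x` of
(3.81): `N(σ, -Δφ)` for `ε = 1` (3.82), `-N(σ, Δ̄φ)` for `ε = -1` (3.83).
[cite: SalmhoferSeiler1991, (3.81)–(3.83)] -/
def linObs (ε : ℤ) (N : ℕ) (φ : TorusSite ν L → ℂ) : FieldAlg ν L :=
  ∑ x : TorusSite ν L, C (linCoeff ε N φ x) * X x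

omit [NeZero L] in
/-- The site term at `φ = 0`: `-Nεν σ_x²`. [cite: SalmhoferSeiler1991, (3.79)] -/
theorem siteTerm_zero (ε : ℤ) (N : ℕ) (x : TorusSite ν L) :
    siteTerm ε N (fun _ : TorusSite ν L => (0 : ℂ)) x =
      C (-((((ε : ℝ) * N * ν : ℝ)) : ℂ)) * X x ^ 2 := by
  simp only [siteTerm, map_zero, sub_zero]
  congr 2
  push_cast
  ring

omit [NeZero L] in
/-- The link term at `φ = 0`: `N σ_x σ_{x+e_μ}`. [cite: SalmhoferSeiler1991, (3.79)] -/
theorem linkTerm_zero (N : ℕ) (x : TorusSite ν L) (μ : Fin ν) :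
    linkTerm N (fun _ : TorusSite ν L => (0 : ℂ)) (x, μ) =
      C (N : ℂ) * (X x * X (x + Pi.single μ 1)) ^ 1 := by
  simp only [linkTerm, map_zero, sub_zero, pow_one]

omit [NeZero L] in
/-- The site and link terms at `φ = 0` have no constant term. [cite: SalmhoferSeiler1991, (3.79)] -/
theorem coeff_zero_hamFamily_zero (ε : ℤ) (N : ℕ) (j : TorusSite ν L ⊕ TorusSite ν L × Fin ν) :
    coeff 0 (hamFamily ε N (fun _ : TorusSite ν L => (0 : ℂ)) j) = 0 := by
  rcases j with x | ⟨x, μ⟩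
  · simp only [hamFamily, Sum.elim_inl, siteTerm_zero]
    rw [coeff_C_mul, ← constantCoeff_eq, map_pow, constantCoeff_X, zero_pow two_ne_zero, mul_zero]
  · simp only [hamFamily, Sum.elim_inr, linkTerm_zero, pow_one]
    rw [coeff_C_mul, ← constantCoeff_eq, map_mul, constantCoeff_X, zero_mul, mul_zero]

/-- `-N H^ε_Λ(0)` has no constant term. [cite: SalmhoferSeiler1991, (3.79)–(3.80)] -/
theorem coeff_zero_negNHam_zero (ε : ℤ) (hε : ε = 1 ∨ ε = -1) (N : ℕ) :
    coeff 0 (negNHam ε N (fun _ : TorusSite ν L => (0 : ℂ))) = 0 := by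
  rw [← sum_hamFamily ε hε N, coeff_sum]
  exact Finset.sum_eq_zero fun j _ => coeff_zero_hamFamily_zero ε N j

/-- The linear observable has no constant term. [cite: SalmhoferSeiler1991, (3.81)] -/
theorem coeff_zero_linObs (ε : ℤ) (N : ℕ) (φ : TorusSite ν L → ℂ) : coeff 0 (linObs ε N φ) = 0 := by
  rw [linObs, coeff_sum]
  exact Finset.sum_eq_zero fun x _ => by rw [coeff_C_mul, coeff_zero_X, mul_zero]

/-- **Completing the square (3.81)**: `-N H^ε_Λ(φ) = -(εN/2)∑(φ_x - εφ_{x+e_μ})² +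
εN ∑ (σ_x - εσ_{x+e_μ})(φ_x - εφ_{x+e_μ}) - N H^ε_Λ(0)`, the middle term collected as `∑_x ℓ_x σ_x`.
[cite: SalmhoferSeiler1991, (3.81)] -/
theorem negNHam_decomp (ε : ℤ) (N : ℕ) (φ : TorusSite ν L → ℂ) :
    negNHam ε N φ =
      C (gaussConst ε N φ) + linObs ε N φ + negNHam ε N (fun _ : TorusSite ν L => (0 : ℂ)) := by
  -- the spin part `A_{x,μ} = σ_x - εσ_{x+e_μ}` of the summand of (3.79)
  set A : TorusSite ν L → Fin ν → FieldAlg ν L :=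
    fun x μ => X x - C (ε : ℂ) * X (x + Pi.single μ 1) with hA
  have hsummand : ∀ (x : TorusSite ν L) (μ : Fin ν),
      ((X x - C (φ x)) - C (ε : ℂ) * (X (x + Pi.single μ 1) - C (φ (x + Pi.single μ 1)))) =
        A x μ - C (linkCfg ε φ x μ) := by
    intro x μ; simp only [hA, linkCfg, map_sub, map_mul, map_intCast]; ring
  have hsummand0 : ∀ (x : TorusSite ν L) (μ : Fin ν),
      ((X x - C ((fun _ : TorusSite ν L => (0 : ℂ)) x)) - C (ε : ℂ) *
        (X (x + Pi.single μ 1) - C ((fun _ : TorusSite ν L => (0 : ℂ)) (x + Pi.single μ 1)))) =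
        A x μ := by
    intro x μ; simp only [hA, map_zero, sub_zero]
  have hsq : ∀ (x : TorusSite ν L) (μ : Fin ν), (A x μ - C (linkCfg ε φ x μ)) ^ 2 =
      A x μ ^ 2 + (C (linkCfg ε φ x μ) ^ 2 + (-2) * (A x μ * C (linkCfg ε φ x μ))) := by
    intro x μ; ring
  -- the cross term, collected site by site
  have hcross : ∑ x : TorusSite ν L, ∑ μ : Fin ν, A x μ * C (linkCfg ε φ x μ) =
      ∑ x : TorusSite ν L, C (∑ μ : Fin ν,
        (linkCfg ε φ x μ - ε * linkCfg ε φ (x - Pi.single μ 1) μ)) * X x := by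
    have hexp : ∀ (x : TorusSite ν L) (μ : Fin ν), A x μ * C (linkCfg ε φ x μ) =
        C (linkCfg ε φ x μ) * X x - C ((ε : ℂ) * linkCfg ε φ x μ) * X (x + Pi.single μ 1) := by
      intro x μ; simp only [hA, map_mul, map_intCast]; ring
    simp_rw [hexp, Finset.sum_sub_distrib]
    have hshift : ∑ x : TorusSite ν L, ∑ μ : Fin ν,
        C ((ε : ℂ) * linkCfg ε φ x μ) * X (x + Pi.single μ 1) =
        ∑ x : TorusSite ν L, ∑ μ : Fin ν,
          C ((ε : ℂ) * linkCfg ε φ (x - Pi.single μ 1) μ) * (X x : FieldAlg ν L) := by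
      rw [Finset.sum_comm, Finset.sum_comm (s := (Finset.univ : Finset (TorusSite ν L)))]
      refine Finset.sum_congr rfl fun μ _ => ?_
      exact Fintype.sum_equiv (Equiv.addRight (Pi.single μ 1)) _ _ fun x => by
        simp only [Equiv.coe_addRight, add_sub_cancel_right]
    rw [hshift, ← Finset.sum_sub_distrib]
    refine Finset.sum_congr rfl fun x _ => ?_
    rw [map_sub, map_sum, map_sum, sub_mul, Finset.sum_mul, Finset.sum_mul]
  -- assemble
  have h0 : negNHam ε N (fun _ : TorusSite ν L => (0 : ℂ)) =
      C (-((N : ℂ) * (ε : ℂ) / 2)) * ∑ x : TorusSite ν L, ∑ μ : Fin ν, A x μ ^ 2 := by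
    unfold negNHam; simp_rw [hsummand0]
  have h1 : (C (gaussConst ε N φ) : FieldAlg ν L) =
      C (-((N : ℂ) * (ε : ℂ) / 2)) * ∑ x : TorusSite ν L, ∑ μ : Fin ν, C (linkCfg ε φ x μ) ^ 2 := by
    simp only [gaussConst, map_mul, map_sum, map_pow]
  have h2 : linObs ε N φ = C (-((N : ℂ) * (ε : ℂ) / 2)) *
      ∑ x : TorusSite ν L, ∑ μ : Fin ν, (-2) * (A x μ * C (linkCfg ε φ x μ)) := by
    have hm : ∀ x : TorusSite ν L, ∑ μ : Fin ν, (-2) * (A x μ * C (linkCfg ε φ x μ)) =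
        (-2) * ∑ μ : Fin ν, A x μ * C (linkCfg ε φ x μ) := fun x => by rw [Finset.mul_sum]
    simp_rw [hm]
    rw [← Finset.mul_sum, hcross, linObs, Finset.mul_sum, Finset.mul_sum]
    refine Finset.sum_congr rfl fun x _ => ?_
    rw [linCoeff]
    set T := ∑ μ : Fin ν, (linkCfg ε φ x μ - ε * linkCfg ε φ (x - Pi.single μ 1) μ) with hT
    rw [show (-2 : FieldAlg ν L) = C (-2 : ℂ) by rw [map_neg, map_ofNat], ← mul_assoc, ← mul_assoc,
      ← map_mul, ← map_mul, show -((N : ℂ) * ε / 2) * -2 * T = (N : ℂ) * ε * T by ring]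
  rw [h0, h1, h2]
  unfold negNHam
  simp_rw [hsummand, hsq, Finset.sum_add_distrib]
  ring

/-- At `φ = 0` the Gaussian constant vanishes. [cite: SalmhoferSeiler1991, (3.81)] -/
theorem gaussConst_zero (ε : ℤ) (N : ℕ) : gaussConst ε N (fun _ : TorusSite ν L => (0 : ℂ)) = 0 := by
  simp [gaussConst, linkCfg]

/-- At `φ = 0` the linear observable vanishes. [cite: SalmhoferSeiler1991, (3.81)] -/
theorem linObs_zero (ε : ℤ) (N : ℕ) : linObs ε N (fun _ : TorusSite ν L => (0 : ℂ)) = 0 := by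
  simp [linObs, linCoeff, linkCfg]

end Decomposition

/-! ### (3.81): the twisted partition function of the background system as a bracket of the
original system -/

section Background

variable [NeZero L]

/-- **The background site data** of (3.78): the Taylor data of `F(σ) e^{εNνσ²}` truncated at degree
`N`, for a site weight `F` with Taylor data `f`. [cite: SalmhoferSeiler1991, (3.78)] -/
def bgSite (ε : ℤ) (N ν : ℕ) (f : ℕ → ℝ) : ℕ → ℝ := gaussTwist ((ε : ℝ) * N * ν) f

/-- The top degree dominates `N` (the torus is nonempty). [cite: SalmhoferSeiler1991, Remark 3.2] -/
theorem le_topDegree (N : ℕ) : N ≤ topDegree ν L N := by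
  rw [topDegree]
  exact Nat.le_mul_of_pos_right N Fintype.card_pos

/-- **(3.81) for the unnormalised background bracket.**  With the background weights of (3.78) —
site weight `F(σ_x) e^{εNνσ_x²}` (data `bgSite ε N ν f`), bond weight `e^{NV(σ_xσ_y)}` (data `b_k`
= `fluctCoeff N a`, (3.73)) — the twisted partition function `Z^ε_Λ(φ) = [e^{-NH^ε_Λ(φ)}]_Λ` (3.80)
equals `exp(-(εN/2)∑_{x,μ}(φ_x - εφ_{x+e_μ})²) · [e^{εN∑(σ_x - εσ_{x+e_μ})(φ_x - εφ_{x+e_μ})}]`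
where the last bracket is that of the ORIGINAL system (site weight `F`, bond weight
`B = e^{NW}` with data `a`): the Gaussian factors `e^{-εNν∑σ_x²} e^{N∑σ_xσ_{x+e_μ}}` of
`e^{-NH^ε_Λ(0)}` turn the background weights into the original ones (`ε = ±1`; `|Λ| ≥ 2`).
[cite: SalmhoferSeiler1991, (3.78), (3.80)–(3.81)] -/
theorem twistedZ_bg_eq (ε : ℤ) (hε : ε = 1 ∨ ε = -1) {N : ℕ} (hN2 : 2 * N ≤ topDegree ν L N)
    (f a : ℕ → ℝ) (φ : TorusSite ν L → ℂ) :
    twistedZ ε N (bgSite ε N ν f) (fluctCoeff N a) φ =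
      Complex.exp (gaussConst ε N φ) *
        bracketC N f a (eT (topDegree ν L N) (linObs ε N φ)) := by
  classical
  rw [twistedZ_eq ε hε, negNHam_decomp]
  dsimp only [cst, tail]
  have hcst : coeff 0 (C (gaussConst ε N φ) + linObs ε N φ +
      negNHam ε N (fun _ : TorusSite ν L => (0 : ℂ))) = gaussConst ε N φ := by
    rw [coeff_add, coeff_add, coeff_zero_C, coeff_zero_linObs, coeff_zero_negNHam_zero ε hε,
      add_zero, add_zero]
  rw [hcst, show C (gaussConst ε N φ) + linObs ε N φ + negNHam ε N (fun _ : TorusSite ν L => (0 : ℂ)) -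
      C (gaussConst ε N φ) = linObs ε N φ + negNHam ε N (fun _ : TorusSite ν L => (0 : ℂ)) by ring]
  refine congrArg₂ (· * ·) rfl ?_
  -- `e_D^{Lin + K₀} ≡ e_D^{Lin} · ∏_j e_D^{K₀,j}` under the bracket
  have hnull : NullEq (topDegree ν L N)
      (eT (topDegree ν L N) (linObs ε N φ + negNHam ε N (fun _ : TorusSite ν L => (0 : ℂ))))
      (eT (topDegree ν L N) (linObs ε N φ) *
        ∏ j, eT (topDegree ν L N) (hamFamily ε N (fun _ : TorusSite ν L => (0 : ℂ)) j)) := by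
    rw [← sum_hamFamily ε hε N]
    refine (eT_add_nullEq _ (coeff_zero_linObs ε N φ) ?_).trans
      ((NullEq.refl _).mul (eT_sum_nullEq _ _ fun j _ => coeff_zero_hamFamily_zero ε N j))
    rw [coeff_sum]; exact Finset.sum_eq_zero fun j _ => coeff_zero_hamFamily_zero ε N j
  rw [← one_mul (eT (topDegree ν L N) (linObs ε N φ + _)), bracketC_congr_of_nullEq _ _ hnull 1]
  -- unfold the two brackets and regroup the Boltzmann weights site by site and link by link
  rw [bracketC, bracketC, boltzmannC, boltzmannC, Fintype.prod_sum_type]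
  simp only [hamFamily, Sum.elim_inl, Sum.elim_inr, Fintype.prod_prod_type, siteTerm_zero,
    linkTerm_zero]
  have hregroup :
      1 * (eT (topDegree ν L N) (linObs ε N φ) *
          ((∏ x : TorusSite ν L, eT (topDegree ν L N) (C (-((((ε : ℝ) * N * ν : ℝ)) : ℂ)) * X x ^ 2)) *
            ∏ x : TorusSite ν L, ∏ μ : Fin ν,
              eT (topDegree ν L N) (C (N : ℂ) * (X x * X (x + Pi.single μ 1)) ^ 1))) *
        ((∏ x : TorusSite ν L, siteWeightC N (bgSite ε N ν f) x) *
          ∏ x : TorusSite ν L, ∏ μ : Fin ν, bondWeightC N (fluctCoeff N a) x (x + Pi.single μ 1)) =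
      eT (topDegree ν L N) (linObs ε N φ) *
        ((∏ x : TorusSite ν L, (siteWeightC N (bgSite ε N ν f) x *
            eT (topDegree ν L N) (C (-((((ε : ℝ) * N * ν : ℝ)) : ℂ)) * X x ^ 2))) *
          ∏ x : TorusSite ν L, ∏ μ : Fin ν, (bondWeightC N (fluctCoeff N a) x (x + Pi.single μ 1) *
            eT (topDegree ν L N) (C (N : ℂ) * (X x * X (x + Pi.single μ 1)) ^ 1))) := by
    simp only [Finset.prod_mul_distrib]
    ring
  rw [hregroup]
  refine TruncEq.coeff_topExponent_eq ((TruncEq.refl _).mul (TruncEq.mul ?_ ?_))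
  · exact TruncEq.prod fun x _ =>
      truncEq_siteWeightC_gaussTwist (le_topDegree N) ((ε : ℝ) * N * ν) f x
  · exact TruncEq.prod fun x _ => TruncEq.prod fun μ _ =>
      truncEq_bondWeightC_fluctCoeff hN2 a x (x + Pi.single μ 1)

/-- **`Z^ε_Λ(0) = Z_Λ`** ("then `Z^ε_Λ(0) = Z_Λ`", p. 413): at `φ = 0` the twisted partition
function of the background system is the partition function `[1]_Λ` of the original system.
[cite: SalmhoferSeiler1991, (3.80)–(3.81)] -/
theorem twistedZ_bg_zero (ε : ℤ) (hε : ε = 1 ∨ ε = -1) {N : ℕ} (hN2 : 2 * N ≤ topDegree ν L N)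
    (f a : ℕ → ℝ) :
    twistedZ ε N (bgSite ε N ν f) (fluctCoeff N a) (fun _ : TorusSite ν L => (0 : ℂ)) =
      bracketC (ν := ν) (L := L) N f a 1 := by
  rw [twistedZ_bg_eq (ν := ν) (L := L) ε hε hN2 f a, gaussConst_zero, linObs_zero, eT_zero,
    Complex.exp_zero, one_mul]

end Background

end ComplexSpin

end Literature.MathematicalPhysics.StatisticalMechanics

end
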